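import Summits.PneNP.PneNP.Theorems.RegularResolutionRung.Negative.OneSidedFalse

/-!
# Line `drc-selfrich-core` for crux `RamseyUncertifiable.RegularResolutionRung` (stmt-PneNP-9818)

crux-plan skeleton, GENERATION 2 (planner-cruxplan-stmt-PneNP-9818-drc-selfrich-core-g2-0,
2026-08-16), superseding generation 1 (planner-cruxplan-stmt-PneNP-9818-drc-selfrich-core-0, commit
fd9a6b63539b) of the same line; from the crux idea card `Cruxes/RegularResolutionRung/Ideas/
drc-selfrich-core.md` (ideator 1, round 1) and the panel notes TRIAGE-r1-{1,2,3}.md (3 × pass).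
Line card: `Lines/drc-selfrich-core.md`.

WHAT CHANGED IN GENERATION 2 (and why). Generation 1's load-bearing stub `stub_fractional`
("FRAC v1": the θ-weight `Σ_B θ^{|B|}` of the INCLUSION-MINIMAL traps is `≤ θ^{r/4}`, for every
trap threshold `q'` down to the bi-density scale `|S|^{1-β}`) is FALSE as stated — refuted on paper
by SUB-SCALE BLOCK DESIGNS (line card §F1): inside `G(n,½)` plant `r+1` bipartite holes
`J_j × W_j` with `|J_j| = |S|^{1-β}/2 - 1` (invisible to bi-density at scale `|S|^{1-β}` and to
self-richness), take `W = ⋃ W_j`, `T = ∅`, `cap = r+1`, `q' = |S|^{1-β}`; every transversal of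
the `J_j` is a minimal trap and their weight is `((|S|^{1-β}/2-1)·θ)^{r+1} ≈ (log₂² n/2)^{r+1} ≫ 1`.
The defect is twofold: (i) the demand `θ^{r/4}` is ABSOLUTE while lower bi-density only caps the
junk vertices per context by `M = |S|^{1-β}`, so any sound demand must be RELATIVE to `M·θ`, i.e.
the trap threshold `q'` must sit polynomially ABOVE the bi-density scale (in the composition it
does: `q' = δ^{⌈k/t⌉}|S|^{1-γ}/(4kt) ≥ M·n^{κ}` once `t` is large, BECAUSE `γ < β`); (ii) the
minimal-trap SUM is the wrong functional altogether — junk vertices with partial holes padded by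
`g` generic vertices give `(e·mθ/g)^g ≫ 1` extra weight per padding level — whereas Case 2a of
ABdRLNR Lemma 6.7 only ever needs a CHEAP COVER of the traps. Generation 2 therefore states the
property in its SPREAD-COVER form FRAC₂: there is a family `𝓒` of vertex sets such that every
trap contains a member of `𝓒` and `Σ_{C∈𝓒} θ^{|C|} ≤ (M·θ·log₂² n)^{r/4}` with `θ = log₂² n/q'`
substituted (no free `θ`), and NO lower bound on `q'` (below `M·log₂⁴ n` the bound is `≥ 1` and
`𝓒 = {∅}` works, so the statement self-trivialises outside the meaningful regime). FRAC₂ is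
(a) exactly what Case 2a consumes (`P[R(α) ∈ 𝓡₀] ≤ Σ_C P[C ⊆ R(α)] ≤ Σ_C θ^{|C|}`, irreversibility
of coin-ones), (b) implied by ABdRLNR's hitting-set property 2 (`𝓒` = the `⌈r/2⌉`-subsets of the
hitting set) and by FRAC v1, hence weaker than both, (c) by LP duality essentially NECESSARY for
the oblivious-coin method: FRAC₂ fails iff the traps carry a `θ`-spread probability measure
(Park–Pham / fractional Kahn–Kalai language), (d) satisfied with room by every design tried —
block / typed / multi-typed / padded designs have optimal cover cost `(M'θ)^{u}`, `u ≥ r/2+1`,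
`M' < M`; random spread planting yields only `~m·2^r` traps. `stub_bottleneck` consumes FRAC₂
verbatim; `stub_core`, `stub_partition`, the proved soundness lemmas and the composition are
generation 1's, unchanged (the constraint `γ < β` of `stub_core` is now visibly load-bearing:
bi-density must hold strictly BELOW the richness scale `|S|^{1-γ}`, as in `G(n,p)`).

THE LINE. Inside an exact-threshold Ramsey graph `G` (both `G` and `Ḡ` are `⌈2log₂ n⌉`-clique-free
— this is where BOTH one-sided obstructions `regularResolutionRung_false_without_complement/_graph`
of `Negative/OneSidedFalse.lean` are honoured: `stub_core` needs the two sides) dependent random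
choice + Erdős–Szemerédi/Prömel–Rödl heredity give a polynomial-size vertex set `S` that is
SELF-RICH (every `≤ c·log₂ n`-subset of `S` has `≥ |S|^{1-γ}` common neighbours INSIDE `S` = ABdRLNR
property 1 verbatim, for all small sets) and two-sided BI-DENSE at the finer scale `|S|^{1-β}`,
`β > γ` (`stub_core`, K1). On `Clique(G,k)` restricted to `S` with random blocks (`stub_partition`,
property 1 per block) the bottleneck count of Atserias–Bonacina–de Rezende–Lauria–Nordström–Razborov
(arXiv:2012.09476 §6: Claim 6.5, Lemma 6.6, Lemma 6.7 Case 1 and Case 2b) runs UNCHANGED with its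
oblivious `θ`-biased path distribution; the only change is Case 2a of Lemma 6.7, where the
hitting-set form of property 2 (false on Ramsey-type cores: planted dead-end cliques, Disproof.lean
(d)) is replaced by the spread-cover form FRAC₂ (`stub_fractional`, K2, the load-bearing open lemma;
`stub_bottleneck` = the known argument consuming it). `RegularResolutionRung_of` composes: soundness
(PROVED below: a refutation of `Clique(H,k)` certifies `K_k`-freeness, so two refutations make `G`
Ramsey) → core → partition + FRAC₂ → bottleneck bound on `π₁ ≤ max`.

CONVENTIONS for provers. Every stub is stated over TREE VOCABULARY ONLY (Mathlib + `Literature` +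
the landed `Theorems/RegularResolutionRung/Negative/*`): `cliqueCNF` is
`Summit.PneNP.PneNP.Theorems.RegularResolutionRung.Negative.cliqueCNF` (the route's inlined `let cnf`,
`regularResolutionRung_iff_restated` is `Iff.rfl`); common neighbourhoods, edge counts, blocks and
traps are inlined `Finset.filter` expressions; `k = Nat.clog 2 (n ^ 2)` is written out. A helper
file `Theorems/RegularResolutionRung<Stub>.lean` (`--supports stmt-PneNP-9818`) copies the two
`open` lines below and the stub statement byte-for-byte. The block FRAC₂ appears twice verbatim:
conclusion of `stub_fractional`, hypothesis of `stub_bottleneck`.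

Inlined vocabulary: `N̂_X(R) = X.filter (fun v => ∀ u ∈ R, G.Adj u v)` (common neighbourhood of `R`
inside `X`); `e(A,B) = ((A ×ˢ B).filter fun p => G.Adj p.1 p.2).card` (ordered edge count);
block `i` of `blk : Fin n → ℕ` inside `S` = `S.filter (blk · = i)`; a TRAP for `(W, T, q', cap)` is
a set `B ⊆ S`, `|B| ≤ cap`, disjoint from `T` and `W`, with `|N̂_W(T ∪ B)| < q'`; a COVER is a
family `𝓒` of vertex sets such that every trap contains some `C ∈ 𝓒`; its COST at coin bias
`θ = log₂² n/q'` is `Σ_{C∈𝓒} θ^{|C|}`.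

Disproof.lean used (cdisprove g2 cycle 1, re-read 2026-08-16): `_false_without_complement` (G = ⊥)
and `_false_without_graph` (G = ⊤) — the line uses BOTH clique-freeness hypotheses at `stub_core`
(density of a Ramsey graph and of its complement); no stub is an instance of
`exists_short_regular_refutation` (⊥/⊤ have no self-rich bi-dense core, and `stub_bottleneck`'s
hypotheses fail for them: ⊥ has no rich blocks; for ⊤ the formula restricted to `S` is satisfiable
once `|S| ≥ k`, so no refutation exists and the stub is vacuous there); calibration (b) `ε ≤ 2`
respected (`ε` is existential and tiny); (d) planted dead-end cliques kill the HITTING-SET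
property 2 — this line never states it (FRAC₂ is the cover replacement; the polynomially many
sporadic traps of TRIAGE-r1-3's second-order junk cost `m·θ^{r/2+1} ≪ (Mθ log₂² n)^{r/4}`).
-/

namespace Summit.PneNP.PneNP.Cruxes.RegularResolutionRung.DrcSelfrichCore

open Literature.Computability.MetaComplexity Literature.Computability.Complexity
open Summit.PneNP.PneNP.Theorems.RegularResolutionRung.Negative

set_option linter.dupNamespace false


/-! ## Proved helper: soundness — a refutation of `Clique(H,k)` certifies `K_k`-freeness

(`Literature…Resolution.not_satisfiable_of_isResRefutation` is a named fact without proof in the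
tree; we prove the instance we need. This is where `RegularResolutionRung_of` learns that a graph
with refutations on both sides is a genuine Ramsey graph.) -/

/-- Soundness of resolution with weakening, line by line: under an assignment satisfying `φ`,
every clause of a derivation from `φ` contains a true literal. -/
theorem exists_true_literal_of_isResDerivation {φ : CNF ℕ} {π : List (ResLine ℕ)}
    (h : IsResDerivation φ π) {σ : ℕ → Bool} (hσ : φ.eval σ = true) :
    ∀ a (ha : a < π.length), ∃ l ∈ (π[a]).clause, Literal.eval σ l = true := by
  intro a
  induction a using Nat.strong_induction_on with
  | _ a ih =>
    intro ha
    have hv := h a ha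
    unfold IsValidResLine at hv
    split at hv
    · -- initial clause
      obtain ⟨cl, hcl, hce⟩ := List.mem_map.1 hv
      have hc : Clause.eval σ cl = true := (CNF.eval_eq_true_iff φ σ).1 hσ cl hcl
      obtain ⟨l, hl, hle⟩ := List.any_eq_true.1 hc
      exact ⟨l, hce ▸ List.mem_toFinset.2 hl, hle⟩
    · -- resolution step
      next i j v _ =>
      obtain ⟨hi, hj, hpos, hneg, hE⟩ := hv
      have hia : i < a := by have := hi; simp at this; exact this.1
      have hja : j < a := by have := hj; simp at this; exact this.1
      simp only [List.getElem_take] at hpos hneg hE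
      obtain ⟨l₁, hl₁, he₁⟩ := ih i hia (lt_trans hia ha)
      obtain ⟨l₂, hl₂, he₂⟩ := ih j hja (lt_trans hja ha)
      rw [hE]
      cases hsv : σ v
      · refine ⟨l₁, Finset.mem_union_left _ (Finset.mem_erase.2 ⟨?_, hl₁⟩), he₁⟩
        rintro rfl
        simp [Literal.eval, hsv] at he₁
      · refine ⟨l₂, Finset.mem_union_right _ (Finset.mem_erase.2 ⟨?_, hl₂⟩), he₂⟩
        rintro rfl
        simp [Literal.eval, hsv] at he₂
    · -- weakening step
      next i _ =>
      obtain ⟨hi, hsub⟩ := hv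
      have hia : i < a := by have := hi; simp at this; exact this.1
      simp only [List.getElem_take] at hsub
      obtain ⟨l₁, hl₁, he₁⟩ := ih i hia (lt_trans hia ha)
      exact ⟨l₁, hsub hl₁, he₁⟩

/-- Soundness: a refuted CNF is unsatisfiable. -/
theorem not_satisfiable_of_isResRefutation {φ : CNF ℕ} {π : List (ResLine ℕ)}
    (h : IsResRefutation φ π) : ¬ φ.Satisfiable := by
  rintro ⟨σ, hσ⟩
  obtain ⟨hd, l, hl, hle⟩ := h
  obtain ⟨a, ha, rfl⟩ := List.mem_iff_getElem.1 hl
  obtain ⟨x, hx, -⟩ := exists_true_literal_of_isResDerivation hd hσ a ha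
  rw [hle] at hx
  simp at hx

/-- Injectivity of the variable numbering `x_{i,u} ↦ i·n + u`. -/
theorem var_inj {n i i' : ℕ} {u u' : ℕ} (hu : u < n) (hu' : u' < n)
    (h : i * n + u = i' * n + u') : i = i' ∧ u = u' := by
  have h1 := digits_of (s := i) hu
  have h2 := digits_of (s := i') hu'
  rw [h] at h1
  exact ⟨h1.1.symm.trans h2.1, h1.2.symm.trans h2.2⟩

/-- A `k`-clique of `H` satisfies `Clique(H,k)`: set `x_{i,v}` true iff `v` is the `i`-th
smallest clique vertex. -/
theorem satisfiable_cliqueCNF_of_isNClique {n k : ℕ} (H : SimpleGraph (Fin n))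
    [DecidableRel H.Adj] {s : Finset (Fin n)} (hs : H.IsNClique k s) :
    (cliqueCNF n k fun u v => decide (H.Adj u v)).Satisfiable := by
  classical
  set f := s.orderEmbOfFin hs.card_eq with hf
  let σ : ℕ → Bool := fun x => decide (∃ i : Fin k, x = (i : ℕ) * n + (f i : ℕ))
  have hσ : ∀ (i : ℕ) (u : Fin n), σ (i * n + u) = true ↔ ∃ hi : i < k, f ⟨i, hi⟩ = u := by
    intro i u
    simp only [σ, decide_eq_true_eq]
    constructor
    · rintro ⟨j, hj⟩
      obtain ⟨h1, h2⟩ := var_inj u.isLt (f j).isLt hj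
      subst h1
      exact ⟨j.isLt, Fin.ext h2.symm⟩
    · rintro ⟨hi, hfi⟩
      exact ⟨⟨i, hi⟩, by rw [hfi]⟩
  refine ⟨σ, (CNF.eval_eq_true_iff _ σ).2 fun cl hcl => ?_⟩
  unfold Clause.eval
  rw [List.any_eq_true]
  unfold cliqueCNF at hcl
  simp only [List.mem_append, List.mem_map, List.mem_flatMap, List.mem_range] at hcl
  rcases hcl with (⟨i, hi, rfl⟩ | ⟨i, hi, u, hu, v, hv, hcl⟩) | ⟨i, hi, j, hj, u, -, v, -, hcl⟩
  · -- block clause `⋁_v x_{i,v}`: the literal of the `i`-th clique vertex is true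
    refine ⟨((i * n + (f ⟨i, hi⟩ : ℕ) : ℕ), true), ?_, ?_⟩
    · exact List.mem_map.2 ⟨(f ⟨i, hi⟩ : ℕ), by simp, rfl⟩
    · simpa [Literal.eval] using (hσ i (f ⟨i, hi⟩)).2 ⟨hi, rfl⟩
  · -- functionality clause `¬x_{i,u} ∨ ¬x_{i,v}`, `u < v`
    simp at hu hv
    obtain ⟨u, rfl⟩ := hu
    obtain ⟨v, rfl⟩ := hv
    split_ifs at hcl with huv
    · simp only [List.mem_singleton] at hcl
      subst hcl
      by_cases h1 : σ (i * n + u) = true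
      · refine ⟨(i * n + (v : ℕ), false), by simp, ?_⟩
        obtain ⟨_, hfu⟩ := (hσ i u).1 h1
        have h2 : σ (i * n + v) = false := by
          by_contra h2
          rw [Bool.not_eq_false] at h2
          obtain ⟨_, hfv⟩ := (hσ i v).1 h2
          have : u = v := hfu.symm.trans hfv
          exact (lt_irrefl _) (this ▸ huv : v < v)
        simpa [Literal.eval] using h2
      · refine ⟨(i * n + (u : ℕ), false), by simp, ?_⟩
        rw [Bool.not_eq_true] at h1
        simpa [Literal.eval] using h1
    · simp at hcl
  · -- edge clause `¬x_{i,u} ∨ ¬x_{j,v}`, `i ≠ j`, `u,v` non-adjacent or equal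
    split_ifs at hcl with hij
    · simp only [List.mem_singleton] at hcl
      subst hcl
      by_cases h1 : σ (i * n + u) = true
      · refine ⟨(j * n + (v : ℕ), false), by simp, ?_⟩
        obtain ⟨hi', hfu⟩ := (hσ i u).1 h1
        have h2 : σ (j * n + v) = false := by
          by_contra h2
          rw [Bool.not_eq_false] at h2
          obtain ⟨hj', hfv⟩ := (hσ j v).1 h2
          have hne : (⟨i, hi'⟩ : Fin k) ≠ ⟨j, hj'⟩ := fun h => hij.1 (Fin.mk.inj_iff.1 h)
          have hadj : H.Adj u v := by
            rw [← hfu, ← hfv]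
            exact hs.isClique (s.orderEmbOfFin_mem _ _) (s.orderEmbOfFin_mem _ _)
              (fun h => hne (f.injective h))
          have := hij.2
          simp [hadj] at this
        simpa [Literal.eval] using h2
      · refine ⟨(i * n + (u : ℕ), false), by simp, ?_⟩
        rw [Bool.not_eq_true] at h1
        simpa [Literal.eval] using h1
    · simp at hcl

/-- **Soundness for the clique formula.** A resolution refutation of `Clique(H,k)` certifies that
`H` is `k`-clique-free. Used twice in `RegularResolutionRung_of` (for `G` and for `Gᶜ`): a graph
with refutations on both sides is an exact-threshold Ramsey graph. -/
theorem cliqueFree_of_isResRefutation {n k : ℕ} (H : SimpleGraph (Fin n)) [DecidableRel H.Adj]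
    {π : List (ResLine ℕ)}
    (h : IsResRefutation (cliqueCNF n k fun u v => decide (H.Adj u v)) π) : H.CliqueFree k := by
  intro s hs
  exact not_satisfiable_of_isResRefutation h (satisfiable_cliqueCNF_of_isNClique H hs)

/-! ## The stubs (S1–S4) -/

/-- **S1 `stub_core` — the DRC SELF-RICH BI-DENSE CORE (K1 of the card; the lever; size L).**
There are constants `c, γ, β, δ, γ' > 0` with `γ < β < 1`, `δ < 1/2`, such that every graph `G` on
`n ≥ n₀` vertices with BOTH `G` and `Ḡ` `⌈2log₂ n⌉`-clique-free (an exact-threshold Ramsey graph)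
contains a vertex set `S`, `|S| ≥ n^{γ'}`, which is
* SELF-RICH: every `R ⊆ S` with `|R| ≤ c·log₂ n` has `≥ |S|^{1-γ}` common neighbours INSIDE `S`
  (ABdRLNR Def. 6.3 property 1 for ALL small sets, not only cliques — Lemma 6.6 takes unions of
  witnesses, so cliques do not suffice), and
* two-sided BI-DENSE at scale `|S|^{1-β}`: `δ|A||B| ≤ e(A,B) ≤ (1-δ)|A||B|` for all `A, B ⊆ S` of
  size `≥ |S|^{1-β}` (TRIAGE-r1-2 sharpening: pair density, not induced density — upper density is
  what excludes the complete-join family of TRIAGE §A, lower density the Turán/colourable family).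
Why plausibly true: dependent random choice `S ⊆ N̂(T₀)` for a random `t = Θ(log n)`-set `T₀`, then
deletion (Fox–Sudakov arXiv:0909.3271 Lemma 2.1), run inside the Prömel–Rödl core (LPRT
arXiv:1303.3166 Lemma 11, two-sided) — a set with few common neighbours is exponentially unlikely to
survive inside `N̂(T₀)`; density of all polynomial-size induced subgraphs of a Ramsey graph
(Erdős–Szemerédi) feeds both halves; loss only polynomial (`γ'` small). Uses BOTH clique-freeness
hypotheses (density away from 0 AND 1): this is the stub that honours
`regularResolutionRung_false_without_complement/_graph`. Why it might fail (TRIAGE-r1-1/3 doubt,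
card's falsifier (a)): SELF-containment — richness inside `S`, not in `V` — needs bad small sets to
be an `|S|^{-Θ(log)}` fraction, more than heredity gives pointwise; and bi-density must hold BELOW
the Prömel–Rödl scale. Constants are existential on purpose (any positive values do downstream).
Leans on: Mathlib `SimpleGraph.CliqueFree`, `Finset.filter`, `Real.logb`; no Literature fact is
proved for this in the tree (PR99 / Fox–Sudakov to be vendored or re-proved `--supports`).
Generation-2 note: the ordering `γ < β` is LOAD-BEARING downstream — lower bi-density caps the junk
vertices of every context of size `≥ |S|^{1-β}` by `|S|^{1-β}`, and FRAC₂/`stub_bottleneck` need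
that cap to be polynomially smaller than the trap threshold `q' ≈ δ^{⌈k/t⌉}|S|^{1-γ}/(4kt)`, i.e.
bi-density strictly below the richness scale (automatic in `G(n,p)`; for the DRC core it means the
richness-range constant `c` — hence `γ ≈ c/γ'` — is chosen small against the Prömel–Rödl exponent
of the ambient two-sided core, which DRC permits since `c` only enters through `t ≥ 8/c`). -/
theorem stub_core :
    ∃ c : ℝ, 0 < c ∧ ∃ γ : ℝ, 0 < γ ∧ ∃ β : ℝ, γ < β ∧ β < 1 ∧ ∃ δ : ℝ, 0 < δ ∧ δ < 1 / 2 ∧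
    ∃ γ' : ℝ, 0 < γ' ∧ ∃ n₀ : ℕ, ∀ n ≥ n₀, ∀ (G : SimpleGraph (Fin n)) [DecidableRel G.Adj],
      G.CliqueFree (Nat.clog 2 (n ^ 2)) → Gᶜ.CliqueFree (Nat.clog 2 (n ^ 2)) →
      ∃ S : Finset (Fin n), (n : ℝ) ^ γ' ≤ S.card ∧
      (∀ R ⊆ S, (R.card : ℝ) ≤ c * Real.logb 2 n →
        (S.card : ℝ) ^ (1 - γ) ≤ ((S.filter fun v => ∀ u ∈ R, G.Adj u v).card : ℝ)) ∧
      (∀ A ⊆ S, ∀ B ⊆ S, (S.card : ℝ) ^ (1 - β) ≤ A.card → (S.card : ℝ) ^ (1 - β) ≤ B.card →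
        δ * A.card * B.card ≤ (((A ×ˢ B).filter fun p => G.Adj p.1 p.2).card : ℝ) ∧
          (((A ×ˢ B).filter fun p => G.Adj p.1 p.2).card : ℝ) ≤ (1 - δ) * A.card * B.card) := by
  sorry

/-- **S2 `stub_partition` — RANDOM BLOCKS keep property 1 (size M, provable now).**
If `S` (`|S| ≥ n^{γ'}`) is self-rich with parameters `(c, γ)`, then there is a block assignment
`blk : Fin n → ℕ` using the `k = ⌈2log₂ n⌉ = Nat.clog 2 (n²)` block indices on `S` such that EVERY
block is rich: for every `i < k` and every `R ⊆ S` with `|R| ≤ c·log₂ n`, at least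
`|S|^{1-γ}/(2k)` vertices of block `i` are common neighbours of `R` (ABdRLNR property 1 per block,
`(tr, tq) = (c log₂ n, |S|^{1-γ}/(2k))`). Why true: a uniformly random `blk : S → [k]`; for fixed
`(i, R)` the count is a sum of `|N̂_S(R)| ≥ |S|^{1-γ}` independent indicators of mean `1/k`, so
`P[count < |S|^{1-γ}/(2k)] ≤ exp(-|S|^{1-γ}/(8k))` (Chernoff lower tail), and a union bound over the
`≤ k·(n+1)^{c log₂ n}` pairs `(i, R)` is `< 1` once `n^{γ'(1-γ)} ≫ k·log² n` (finite averaging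
over all `k^{|S|}` maps suffices — no measure theory needed). No balance is claimed (not used by the
count). Leans on: Mathlib `Finset.sum`/double counting or `ProbabilityTheory` Chernoff–Hoeffding if
preferred; `Real.logb`, `Nat.clog`. -/
theorem stub_partition :
    ∀ c γ γ' : ℝ, 0 < c → 0 < γ → γ < 1 → 0 < γ' →
    ∃ n₀ : ℕ, ∀ n ≥ n₀, ∀ (G : SimpleGraph (Fin n)) [DecidableRel G.Adj] (S : Finset (Fin n)),
      (n : ℝ) ^ γ' ≤ S.card →
      (∀ R ⊆ S, (R.card : ℝ) ≤ c * Real.logb 2 n →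
        (S.card : ℝ) ^ (1 - γ) ≤ ((S.filter fun v => ∀ u ∈ R, G.Adj u v).card : ℝ)) →
      ∃ blk : Fin n → ℕ, (∀ v ∈ S, blk v < Nat.clog 2 (n ^ 2)) ∧
      (∀ i < Nat.clog 2 (n ^ 2), ∀ R ⊆ S, (R.card : ℝ) ≤ c * Real.logb 2 n →
        (S.card : ℝ) ^ (1 - γ) / (2 * Nat.clog 2 (n ^ 2)) ≤
          ((S.filter fun v => blk v = i ∧ ∀ u ∈ R, G.Adj u v).card : ℝ)) := by
  sorry

/-- **S3 `stub_fractional` — SPREAD-COVER MOSTLY-DENSENESS FRAC₂ (K2 of the card; the HARDEST,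
load-bearing stub; size L, open; generation-2 restatement — FRAC v1 of generation 1 is refuted,
see the module docstring and the line card §F1).** In a self-rich (`c, γ`), two-sided bi-dense
(`β, δ`, scale `|S|^{1-β}`, `γ < β`) set `S` with `|S| ≥ n^{γ'}`, for every admissible parameter
tuple — every `W ⊆ S` that is `(r,q)`-dense (`|N̂_W(R)| ≥ q` for all `R ⊆ S`, `|R| ≤ r`), every
clique `T ⊆ S` disjoint from `W` with `2|T| ≤ r` (in the application `T = V¹(a)`), logarithmic
`r ≥ log₂ n/C₁`, every cap with `cap + r ≤ c·log₂ n` (traps inside the richness range) and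
`cap·min(c,1) ≤ 3r` (traps at most a constant factor longer than `r`; the count uses
`cap = ⌈k/t⌉ ≤ 2r/min(c,1) + 1`), and every trap threshold `0 < q' ≤ δ^{cap}·q/2` (a trap must
lose more than a `δ`-factor per vertex on average, so generic vertices never trap) — the TRAPS
`B ⊆ S` (`|B| ≤ cap`, `B ∩ T = ∅`, `B ∩ W = ∅`, `|N̂_W(T ∪ B)| < q'`) admit a COVER `𝓒` (every
trap contains some `C ∈ 𝓒`) of small COST at coin bias `θ := log₂² n/q'`:
`(Σ_{C∈𝓒} θ^{|C|})^4 ≤ (|S|^{1-β}·log₂⁴ n/q')^r`, i.e. cost `≤ (M·θ·log₂² n)^{r/4}` with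
`M = |S|^{1-β}` the junk cap of lower bi-density. This is exactly what Case 2a of ABdRLNR Lemma 6.7
consumes once the hitting set of Def. 6.2 is gone (`P[R(α) ∈ 𝓡₀] ≤ Σ_C P[C ⊆ R(α)] ≤ Σ_C θ^{|C|}`
by irreversibility of coin-ones), and it is the weakest such statement: by LP duality a cheap cover
fails to exist iff the traps support a `θ`-spread measure, i.e. iff oblivious `θ`-coins WOULD be
trapped (Park–Pham) — so a refutation of FRAC₂ in the composition's regime kills the whole
oblivious-coin method on that core, not just this phrasing.
Why plausibly true: `(r,q)`-density of `W` and `q' < q` force `|T ∪ B| > r`; along any ordering of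
a trap the last `|T∪B| - r ≤ cap` vertices lose a factor `< δ^{cap}/2` in total, so at least one
step is `δ`-JUNK for its context (`|N(x) ∩ X| < δ|X|`, `|X| ≥ q' ≫ |S|^{1-β}`), and lower
bi-density caps each context's junk set by `M = |S|^{1-β}`; a junk vertex only traps contexts
ALIGNED with its hole, which forces the other trap vertices to be junk for their contexts too
(generic vertices spread common neighbourhoods uniformly), so traps are assembled from `≤ M`-size
junk pools: block / typed / multi-typed / padded designs all have optimal cover cost `(M'θ)^{u}`
with `u ≥ r/2 + 1` uncovered "types" and `M' < M`, below the demand as soon as `Mθlog₂² n < 1`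
(and when `Mθ log₂² n ≥ 1` the demand is `≥ 1` and `𝓒 = {∅}` works); in `G(m,½)`-like `S` junk
sets are empty and there are no traps; exact algebraic designs (affine hyperplanes over `𝔽₂`,
r-wise independent labels with odd `(r+1)`-dependencies) would give spread traps but need
`|W| ≥ (m/r)^{r/2} = n^{Θ(log n)}`; random spread planting affords only `≈ 2^r` planted traps per
vertex (each costs a `q`-hole in `N_W(x)`), total cost `m2^r θ^{r+1} ≪ (Mθlog₂² n)^{r/4}`.
Why it might fail (honest gap): by LP duality FRAC₂ fails iff some `(r,q)`-dense `W` and clique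
`T` admit a probability measure on traps that is SPREAD at rate `θ` beyond the demand (every
`u`-set lies in at most a `θ^{u}·(Mθ log₂² n)^{-r/4}` fraction of the traps) — roughly
`≥ q'^{3r/4}·M^{r/4}` traps in general position, far more than the `M^{O(r)}` that aligned junk
pools give; whether a deterministic design below the bi-density scale can realise this inside a
self-rich bi-dense `S` with polynomial `|W|` is an approximate-design question at `r = Θ(log n)`
that neither SR nor BD decides; the stub bets that polynomial `|W|` together with `(r,q)`-density
for ALL `≤ r`-subsets of `S` excludes it (exact designs need `|W| = n^{Θ(log n)}`).
Leans on: Mathlib `Finset.powerset/filter/sum`, `SimpleGraph.IsClique`, `Real.logb/rpow`. -/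
theorem stub_fractional :
    ∀ c γ β δ γ' C₁ : ℝ, 0 < c → 0 < γ → γ < β → β < 1 → 0 < δ → δ < 1 / 2 → 0 < γ' → 0 < C₁ →
    ∃ n₀ : ℕ, ∀ n ≥ n₀, ∀ (G : SimpleGraph (Fin n)) [DecidableRel G.Adj] (S : Finset (Fin n)),
      (n : ℝ) ^ γ' ≤ S.card →
      (∀ R ⊆ S, (R.card : ℝ) ≤ c * Real.logb 2 n →
        (S.card : ℝ) ^ (1 - γ) ≤ ((S.filter fun v => ∀ u ∈ R, G.Adj u v).card : ℝ)) →
      (∀ A ⊆ S, ∀ B ⊆ S, (S.card : ℝ) ^ (1 - β) ≤ A.card → (S.card : ℝ) ^ (1 - β) ≤ B.card →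
        δ * A.card * B.card ≤ (((A ×ˢ B).filter fun p => G.Adj p.1 p.2).card : ℝ) ∧
          (((A ×ˢ B).filter fun p => G.Adj p.1 p.2).card : ℝ) ≤ (1 - δ) * A.card * B.card) →
      (∀ (W T : Finset (Fin n)) (r cap : ℕ) (q q' : ℝ),
        W ⊆ S → T ⊆ S → Disjoint W T → G.IsClique (↑T : Set (Fin n)) → 2 * T.card ≤ r →
        Real.logb 2 n ≤ C₁ * r → ((cap + r : ℕ) : ℝ) ≤ c * Real.logb 2 n →
        (cap : ℝ) * min c 1 ≤ 3 * r → 0 < q' → q' ≤ δ ^ cap * q / 2 →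
        (∀ R ⊆ S, R.card ≤ r → q ≤ ((W.filter fun v => ∀ u ∈ R, G.Adj u v).card : ℝ)) →
        ∃ 𝓒 : Finset (Finset (Fin n)),
          (∀ B ⊆ S, B.card ≤ cap → Disjoint T B → Disjoint W B →
            ((W.filter fun v => ∀ u ∈ T ∪ B, G.Adj u v).card : ℝ) < q' → ∃ C ∈ 𝓒, C ⊆ B) ∧
          (𝓒.sum fun C => (Real.logb 2 n ^ 2 / q') ^ C.card) ^ 4 ≤
            ((S.card : ℝ) ^ (1 - β) * Real.logb 2 n ^ 4 / q') ^ r) := by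
  sorry

/-- **S4 `stub_bottleneck` — ABdRLNR's BOTTLENECK COUNT run on the spread-cover property (known
proof, arXiv:2012.09476 §6 Thm 6.4 / Claim 6.5 / Lemmas 6.6–6.7, with Case 2a of Lemma 6.7 fed by
FRAC₂ instead of the hitting set; size XL — mostly formalisation).** For all constants (`γ < β`)
there are `C₁` (announced: `2t/min(c,1)` for the piece number `t` the count will use, so that
`stub_fractional` can be invoked at it) and `ε > 0` such that for `n ≥ n₀`: if `S`
(`|S| ≥ n^{γ'}`) carries blocks `blk` with property 1 at `(c·log₂ n, |S|^{1-γ}/(2k))` and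
satisfies FRAC₂ (at `C₁`, with junk scale `|S|^{1-β}` in its cost bound), then EVERY regular
resolution refutation `π` of the UNARY `Clique(G, k)`, `k = Nat.clog 2 (n²)` (the route's
`cliqueCNF`, all `n` vertices, all `k` blocks) has `|π| ≥ n^{ε·log₂ n}`.
Proof plan (all standard; constants first): `t :=` an integer
`≥ max(8/min(c,1), 4·log₂(1/δ)/(γ'(β-γ)))`, so `κ := γ'(β-γ) - (2/t)·log₂(1/δ) ≥ γ'(β-γ)/2 > 0`;
`C₁ := 2t/min(c,1)`; `r := ⌊min(c,1)·log₂ n/t⌋`; `cap := ⌈k/t⌉` (then `cap·min(c,1) ≤ 3r`,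
`cap + r ≤ c·log₂ n`, `cap ≤ t·r/2` for large `n`); `q := |S|^{1-γ}/(2kt)`; `q' := δ^{cap}·q/2`;
`θ := log₂² n/q'`; check `|S|^{1-β}·log₂⁴ n/q' = |S|^{-(β-γ)}δ^{-cap}·8kt·log₂⁴ n ≤ n^{-κ+o(1)}`.
(i) RESTRICT `π` by `x_{i,v} := 0` unless `v ∈ S ∧ blk v = i` — a regular refutation, no longer,
of the block formula `Clique_block(G[S], k, blk)` (block, in-block functionality and cross-block
edge clauses; `u = v` edge clauses die since `blk` is a function; weakening steps are spliced
out); (ii) regular refutation ↦ read-once branching program for the falsified-clause search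
problem with `≤ |π|` nodes (Krajíček; ABdRLNR §2; the tree's `IsRegular` = no pivot twice on a
DAG path = read-once); (iii) the path distribution `𝒟` with forced zeros and `θ`-coins; Claim 6.5
(≤ k ones); Lemma 6.6 verbatim from property 1 with `t·r ≤ min(c,1)·log₂ n` (the `t` pieces'
witnesses `R_j ⊆ S` have `|⋃R_j| ≤ tr`, contradiction with block richness `≥ |S|^{1-γ}/(2k) = tq`);
Lemma 6.7 for a good pair `(a,b)` with `W = V⁰_{i*}(b) ∖ V⁰_{i*}(a) ⊆ S` `(r,q)`-dense: Case 1
(`|V¹(a)| > r/2`): `θ^{(r+1)/2}`; Case 2a: `T := V¹(a)` is a clique `⊆ S ∖ W` with `2|T| ≤ r`,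
`R(α) ⊆ S ∖ (T ∪ W)`, `|R(α)| ≤ cap`, so `R(α) ∈ 𝓡₀` means `R(α)` is a trap, hence contains some
`C ∈ 𝓒`, and `P[C ⊆ R(α)] ≤ θ^{|C|}` (every 1 is a pre-sampled `θ`-coin; irreversibility), so
FRAC₂ gives `P ≤ Σ_C θ^{|C|} ≤ (|S|^{1-β}θ log₂² n)^{r/4} ≤ n^{-(κ-o(1))r/4}`; Case 2b: the
`≥ q'` vertices of `N̂_W(T ∪ R(α))` are all answered 0 by free coins (no forgetting of `i*`, no
functionality forcing as `V¹_{i*} = ∅` before `b`, no edge forcing by definition of `N̂`):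
`≤ (1-θ)^{q'} ≤ e^{-log₂² n}`; union bound: `#pairs ≥ ½·min(θ^{-(r+1)/2}, …)`, `#nodes ≥ √#pairs
≥ n^{(κ·min(c,1)/(11t))·log₂ n}` for large `n`, using `θ^{-1} = q'/log₂² n ≥ n^{κ}` as well; so
`ε := κ·min(c,1)/(11t)`. Why it might fail: only through a formalisation gap (the BP
correspondence for the tree's list-of-lines format with weakening; bookkeeping of `β(a)` for DAGs
with weakening nodes), not mathematically — every probabilistic step is finite averaging over coin
strings. Degenerate inputs are vacuous: if `G[S]` has a block-respecting `k`-clique no refutation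
exists; `⊥`/`⊤` fail property 1 / have no refutation. Leans on: `IsResRefutation`, `IsRegular`,
`IsDagPath`, `pivotsAlong` (Resolution.lean), `Negative.cliqueCNF/block_mem/edge_mem`, Mathlib
`Real.logb/rpow`, `Nat.clog`, `Finset.sum` (finite averaging). -/
theorem stub_bottleneck :
    ∀ c γ β δ γ' : ℝ, 0 < c → 0 < γ → γ < β → β < 1 → 0 < δ → δ < 1 / 2 → 0 < γ' →
    ∃ C₁ : ℝ, 0 < C₁ ∧ ∃ ε : ℝ, 0 < ε ∧ ∃ n₀ : ℕ, ∀ n ≥ n₀,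
      ∀ (G : SimpleGraph (Fin n)) [DecidableRel G.Adj] (S : Finset (Fin n)) (blk : Fin n → ℕ),
      (n : ℝ) ^ γ' ≤ S.card →
      (∀ v ∈ S, blk v < Nat.clog 2 (n ^ 2)) →
      (∀ i < Nat.clog 2 (n ^ 2), ∀ R ⊆ S, (R.card : ℝ) ≤ c * Real.logb 2 n →
        (S.card : ℝ) ^ (1 - γ) / (2 * Nat.clog 2 (n ^ 2)) ≤
          ((S.filter fun v => blk v = i ∧ ∀ u ∈ R, G.Adj u v).card : ℝ)) →
      (∀ (W T : Finset (Fin n)) (r cap : ℕ) (q q' : ℝ),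
        W ⊆ S → T ⊆ S → Disjoint W T → G.IsClique (↑T : Set (Fin n)) → 2 * T.card ≤ r →
        Real.logb 2 n ≤ C₁ * r → ((cap + r : ℕ) : ℝ) ≤ c * Real.logb 2 n →
        (cap : ℝ) * min c 1 ≤ 3 * r → 0 < q' → q' ≤ δ ^ cap * q / 2 →
        (∀ R ⊆ S, R.card ≤ r → q ≤ ((W.filter fun v => ∀ u ∈ R, G.Adj u v).card : ℝ)) →
        ∃ 𝓒 : Finset (Finset (Fin n)),
          (∀ B ⊆ S, B.card ≤ cap → Disjoint T B → Disjoint W B →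
            ((W.filter fun v => ∀ u ∈ T ∪ B, G.Adj u v).card : ℝ) < q' → ∃ C ∈ 𝓒, C ⊆ B) ∧
          (𝓒.sum fun C => (Real.logb 2 n ^ 2 / q') ^ C.card) ^ 4 ≤
            ((S.card : ℝ) ^ (1 - β) * Real.logb 2 n ^ 4 / q') ^ r) →
      ∀ π : List (ResLine ℕ),
        IsResRefutation (cliqueCNF n (Nat.clog 2 (n ^ 2)) fun u v => decide (G.Adj u v)) π →
        IsRegular π → (n : ℝ) ^ (ε * Real.logb 2 n) ≤ (π.length : ℝ) := by
  sorry

/-! ## The composition: the four stubs (and proved soundness) give the crux, BY NAME -/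

/-- `RegularResolutionRung` from S1–S4 (pure logic, no `sorry` of its own). Constants from
`stub_core`; `C₁, ε` from `stub_bottleneck`; thresholds maxed. Given regular refutations `π₁` of
`Clique(G,k)` and `π₂` of `Clique(Ḡ,k)`, soundness makes `G` an exact-threshold Ramsey graph, the
core `S` exists, random blocks give property 1, `stub_fractional` gives FRAC₂ at `C₁`, and
`stub_bottleneck` bounds `|π₁|`, hence the `max`. (The `Ḡ`-side refutation is used exactly once:
to certify `Ḡ` clique-free for `stub_core`.) -/
theorem RegularResolutionRung_of :
    Summit.PneNP.PneNP.Theses.RamseyUncertifiable.RegularResolutionRung := by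
  refine regularResolutionRung_iff_restated.2 ?_
  obtain ⟨c, hc, γ, hγ, β, hγβ, hβ1, δ, hδ, hδ2, γ', hγ', n₁, hcore⟩ := stub_core
  have hγ1 : γ < 1 := hγβ.trans hβ1
  obtain ⟨n₄, hpart⟩ := stub_partition c γ γ' hc hγ hγ1 hγ'
  obtain ⟨C₁, hC₁, ε, hε, n₂, hbn⟩ := stub_bottleneck c γ β δ γ' hc hγ hγβ hβ1 hδ hδ2 hγ'
  obtain ⟨n₃, hfrac⟩ := stub_fractional c γ β δ γ' C₁ hc hγ hγβ hβ1 hδ hδ2 hγ' hC₁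
  refine ⟨ε, hε, max n₁ (max n₂ (max n₃ n₄)), ?_⟩
  intro n hn G _ π₁ π₂ h₁ r₁ h₂ _
  have hn₁ : n₁ ≤ n := le_trans (le_max_left _ _) hn
  have hn₂ : n₂ ≤ n := le_trans (le_trans (le_max_left _ _) (le_max_right _ _)) hn
  have hn₃ : n₃ ≤ n :=
    le_trans (le_trans (le_trans (le_max_left _ _) (le_max_right _ _)) (le_max_right _ _)) hn
  have hn₄ : n₄ ≤ n :=
    le_trans (le_trans (le_trans (le_max_right _ _) (le_max_right _ _)) (le_max_right _ _)) hn
  -- both sides clique-free: `G` is an exact-threshold Ramsey graph (soundness, proved above)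
  have hG : G.CliqueFree (Nat.clog 2 (n ^ 2)) := cliqueFree_of_isResRefutation G h₁
  have hGc : Gᶜ.CliqueFree (Nat.clog 2 (n ^ 2)) := cliqueFree_of_isResRefutation Gᶜ h₂
  -- S1: the self-rich bi-dense core
  obtain ⟨S, hS, hSR, hBD⟩ := hcore n hn₁ G hG hGc
  -- S2: blocks with property 1
  obtain ⟨blk, hblk, hP1⟩ := hpart n hn₄ G S hS hSR
  -- S3: the spread-cover property FRAC₂ at the announced `C₁`
  have hF := hfrac n hn₃ G S hS hSR hBD
  -- S4: the bottleneck bound for `π₁`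
  have hπ₁ := hbn n hn₂ G S blk hS hblk hP1 hF π₁ h₁ r₁
  exact hπ₁.trans (le_max_left _ _)

end Summit.PneNP.PneNP.Cruxes.RegularResolutionRung.DrcSelfrichCore
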